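import Literature.Probability.Percolation.TwoSetExchange
import HarnessLib

/-!
# `NoHeavyLowerTail` (stmt-CriticalPhenomena-4575) — the GIANT TRANSFER of Kozma–Nitzan's Theorem-2 exchange steps

Support file (prover `prim-lf-7`, lemma factory "k-cluster conditional association"; `--supports stmt-CriticalPhenomena-4575`).
No definitions, no named facts, no sorries.

Bond percolation `μ = prodBernoulli w` on `Fin n`, relay set `A`, level `j`; for a vertex `v`, "heavy" `:= j+1 ≤ |π(v)|`, "light" `:= |π(v)| ≤ j`
(`|π(v)| = (A.filter fun a => ω ∈ openConn v a).card`).  For disjoint vertex sets `S, T` put `D = {S ↮ T}`,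
`Att = ⋃_{s∈S} {s ↔ o}` ("`o` attached to `S`"), `H_S = ⋂_{s∈S} {s heavy}`, `H_T = ⋂_{t∈T} {t heavy}`.

* `giant_knStep` — the pair of van den Berg–Häggström–Kahn steps behind Kozma–Nitzan's Theorem 2 (arXiv:2401.12397, pp. 8–9:
  "Applying the BHK inequality to each of these (a total of 6 applications) we find that I ≥ φ(1,2)(m₁₂ − m₃) …") with the SINK REPLACED BY
  HEAVINESS:   `[μ(D ∩ Att ∩ H_S) − μ(D ∩ Att ∩ H_T)] · μ(D) ≥ μ(D ∩ Att) · [μ(D ∩ H_S) − μ(D ∩ H_T)]`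
  (`Att`, `H_S` are of type (+) and `H_T` of type (−) for `(C_S, C_T)`; two instances of `Literature.setTwoClusterExchange`).
* `GiantKn.pairStep` (`S = {x,y}, T = {c}`) and `GiantKn.sideStep` (`S = {u}, T = {v,c}`) — the same steps on the ladder `|A| ≤ 2j+1`
  with all events identified as cells of the attached-champion inequality `XZ₂`:  KN's `I ≥ φ(12)(m₁₂ − m₃)` and `II ≥ φ(1)(m₁ − m₂₃)`
  in giant form (`m_B` ↦ `μ(B heavy, the other two light)`).  Assembled with `knK_lemma2` into `xz2_of_knRegime` in the sequel file
  `…GiantKnTheoremTwo.lean` (prim-lf-7 CANDIDATES.md, batch 6).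
-/

noncomputable section

namespace Summit.CriticalPhenomena.PercolationContinuityZ3.Theorems

open MeasureTheory Set Literature.Probability.LatticeModels Literature.Probability.Percolation
open scoped Classical BigOperators

variable {n : ℕ}


/-- **Giant KN exchange step (PROVED).**  For vertex sets `S, T`, an observer `o`, relays `A`, level `j`, with `D = {S ↮ T}`,
`Att = ⋃_{s∈S}{s ↔ o}`, `H_S = ⋂_{s∈S}{s heavy}`, `H_T = ⋂_{t∈T}{t heavy}`:
`(μ(D ∩ Att ∩ H_S) − μ(D ∩ Att ∩ H_T)) · μ(D) ≥ μ(D ∩ Att) · (μ(D ∩ H_S) − μ(D ∩ H_T))`.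
[cite: VandenbergHaggstromKahn2005, Thm. 2.1 (p. 9) at q = 1 — two applications via `setTwoClusterExchange`; KozmaNitzan2024, proof of Thm. 2 (pp. 8–9)] -/
theorem giant_knStep (w : Sym2 (Fin n) → unitInterval) (A : Finset (Fin n)) (S T : Set (Fin n)) (o : Fin n) (j : ℕ) :
    ((prodBernoulli w).real ({ω : BondConfig (Fin n) | ∀ s ∈ S, ∀ t ∈ T, ¬ (openGraph ω).Reachable s t} ∩
          ((⋃ s ∈ S, (openConn s o : Set (BondConfig (Fin n)))) ∩
            {ω | ∀ s ∈ S, j + 1 ≤ (A.filter fun a => ω ∈ openConn s a).card})) -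
        (prodBernoulli w).real ({ω : BondConfig (Fin n) | ∀ s ∈ S, ∀ t ∈ T, ¬ (openGraph ω).Reachable s t} ∩
          ((⋃ s ∈ S, (openConn s o : Set (BondConfig (Fin n)))) ∩
            {ω | ∀ t ∈ T, j + 1 ≤ (A.filter fun a => ω ∈ openConn t a).card}))) *
      (prodBernoulli w).real {ω : BondConfig (Fin n) | ∀ s ∈ S, ∀ t ∈ T, ¬ (openGraph ω).Reachable s t} ≥
    (prodBernoulli w).real ({ω : BondConfig (Fin n) | ∀ s ∈ S, ∀ t ∈ T, ¬ (openGraph ω).Reachable s t} ∩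
          ⋃ s ∈ S, (openConn s o : Set (BondConfig (Fin n)))) *
      ((prodBernoulli w).real ({ω : BondConfig (Fin n) | ∀ s ∈ S, ∀ t ∈ T, ¬ (openGraph ω).Reachable s t} ∩
          {ω | ∀ s ∈ S, j + 1 ≤ (A.filter fun a => ω ∈ openConn s a).card}) -
        (prodBernoulli w).real ({ω : BondConfig (Fin n) | ∀ s ∈ S, ∀ t ∈ T, ¬ (openGraph ω).Reachable s t} ∩
          {ω | ∀ t ∈ T, j + 1 ≤ (A.filter fun a => ω ∈ openConn t a).card})) := by
  set μ := prodBernoulli w with hμ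
  set D : Set (BondConfig (Fin n)) := {ω | ∀ s ∈ S, ∀ t ∈ T, ¬ (openGraph ω).Reachable s t} with hD
  set Att : Set (BondConfig (Fin n)) := ⋃ s ∈ S, (openConn s o : Set (BondConfig (Fin n))) with hAtt
  set HS : Set (BondConfig (Fin n)) := {ω | ∀ s ∈ S, j + 1 ≤ (A.filter fun a => ω ∈ openConn s a).card} with hHS
  set HT : Set (BondConfig (Fin n)) := {ω | ∀ t ∈ T, j + 1 ≤ (A.filter fun a => ω ∈ openConn t a).card} with hHT
  -- monotonicity of a single cluster under the union hypothesis
  have card_mono : ∀ {X : Set (Fin n)} {s : Fin n}, s ∈ X → ∀ ⦃ω ω' : BondConfig (Fin n)⦄,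
      (⋃ x ∈ X, openEdgeCluster ω x) ⊆ (⋃ x ∈ X, openEdgeCluster ω' x) →
      (A.filter fun a => ω ∈ openConn s a).card ≤ (A.filter fun a => ω' ∈ openConn s a).card := by
    intro X s hs ω ω' h
    have hc : openEdgeCluster ω s ⊆ openEdgeCluster ω' s := TwoSetExchange.openEdgeCluster_mono_of_biUnion hs h
    apply Finset.card_le_card
    intro a ha
    rw [Finset.mem_filter] at ha ⊢
    refine ⟨ha.1, ?_⟩
    change (openGraph ω').Reachable s a
    rw [reachable_iff_exists_mem_openEdgeCluster]
    rcases (reachable_iff_exists_mem_openEdgeCluster ω s a).1 ha.2 with h1 | ⟨e, he, hve⟩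
    · exact Or.inl h1
    · exact Or.inr ⟨e, hc he, hve⟩
  have hAtt_type : ∀ ⦃ω ω' : BondConfig (Fin n)⦄, (⋃ s ∈ S, openEdgeCluster ω s) ⊆ (⋃ s ∈ S, openEdgeCluster ω' s) →
      (⋃ t ∈ T, openEdgeCluster ω' t) ⊆ (⋃ t ∈ T, openEdgeCluster ω t) → ω ∈ Att → ω' ∈ Att :=
    fun ω ω' hs ht h => TwoSetExchange.typePlus_biUnion_openConn S T o hs ht h
  have hHS_type : ∀ ⦃ω ω' : BondConfig (Fin n)⦄, (⋃ s ∈ S, openEdgeCluster ω s) ⊆ (⋃ s ∈ S, openEdgeCluster ω' s) →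
      (⋃ t ∈ T, openEdgeCluster ω' t) ⊆ (⋃ t ∈ T, openEdgeCluster ω t) → ω ∈ HS → ω' ∈ HS :=
    fun ω ω' hs _ h s hsS => le_trans (h s hsS) (card_mono hsS hs)
  have hHT_type : ∀ ⦃ω ω' : BondConfig (Fin n)⦄, (⋃ s ∈ S, openEdgeCluster ω' s) ⊆ (⋃ s ∈ S, openEdgeCluster ω s) →
      (⋃ t ∈ T, openEdgeCluster ω t) ⊆ (⋃ t ∈ T, openEdgeCluster ω' t) → ω ∈ HT → ω' ∈ HT :=
    fun ω ω' _ ht h t htT => le_trans (h t htT) (card_mono htT ht)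
  -- (i) positive correlation of Att and HS given D:  μ(D∩Att)·μ(D∩HS) ≤ μ(D∩Att∩HS)·μ(D)
  have k1 := setTwoClusterExchange w S T (A₁ := Att) (A₂ := HS) (B₁ := univ) (B₂ := univ)
    hAtt_type hHS_type (fun _ _ _ _ _ => mem_univ _) (fun _ _ _ _ _ => mem_univ _)
  -- (ii) negative correlation of Att and HT given D:  μ(D∩Att∩HT)·μ(D) ≤ μ(D∩Att)·μ(D∩HT)
  have k2 := setTwoClusterExchange w S T (A₁ := Att) (A₂ := univ) (B₁ := HT) (B₂ := univ)
    hAtt_type (fun _ _ _ _ _ => mem_univ _) hHT_type (fun _ _ _ _ _ => mem_univ _)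
  simp only [inter_univ] at k1 k2
  change μ.real (D ∩ Att) * μ.real (D ∩ HS) ≤ μ.real (D ∩ (Att ∩ HS)) * μ.real D at k1
  change μ.real (D ∩ (Att ∩ HT)) * μ.real D ≤ μ.real (D ∩ Att) * μ.real (D ∩ HT) at k2
  nlinarith [k1, k2]

namespace GiantKn

/-- Ladder toolkit (PROVED): on `|A| ≤ 2j+1`, (i) joined vertices have the same trace size, (ii) a light and a heavy vertex are not joined,
(iii) a vertex not joined to a heavy vertex is light (two heavy clusters would need `2j+2 > |A|` relays). -/
theorem toolkit (A : Finset (Fin n)) (j : ℕ) (hA : A.card ≤ 2 * j + 1) :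
    (∀ {u v : Fin n} {ω : BondConfig (Fin n)}, (openGraph ω).Reachable u v →
        (A.filter fun a => ω ∈ openConn u a).card = (A.filter fun a => ω ∈ openConn v a).card) ∧
      (∀ {u v : Fin n} {ω : BondConfig (Fin n)}, (A.filter fun a => ω ∈ openConn u a).card ≤ j →
        j + 1 ≤ (A.filter fun a => ω ∈ openConn v a).card → ¬ (openGraph ω).Reachable u v) ∧
      (∀ {u v : Fin n} {ω : BondConfig (Fin n)}, ¬ (openGraph ω).Reachable u v →
        j + 1 ≤ (A.filter fun a => ω ∈ openConn v a).card → (A.filter fun a => ω ∈ openConn u a).card ≤ j) := by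
  have card_eq : ∀ {u v : Fin n} {ω : BondConfig (Fin n)}, (openGraph ω).Reachable u v →
      (A.filter fun a => ω ∈ openConn u a).card = (A.filter fun a => ω ∈ openConn v a).card := by
    intro u v ω h; congr 1; ext b
    simp only [Finset.mem_filter, openConn, mem_setOf_eq]
    exact and_congr_right fun _ => ⟨fun hub => h.symm.trans hub, fun hvb => h.trans hvb⟩
  refine ⟨card_eq, ?_, ?_⟩
  · intro u v ω hl hh h; rw [card_eq h] at hl; omega
  · intro u v ω huv hv
    by_contra hu
    push Not at hu
    have hdisj : Disjoint (A.filter fun a => ω ∈ openConn u a) (A.filter fun a => ω ∈ openConn v a) := by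
      rw [Finset.disjoint_left]; intro a hau hav
      rw [Finset.mem_filter] at hau hav
      exact huv (hau.2.trans hav.2.symm)
    have hsub : (A.filter fun a => ω ∈ openConn u a) ∪ (A.filter fun a => ω ∈ openConn v a) ⊆ A :=
      Finset.union_subset (Finset.filter_subset _ _) (Finset.filter_subset _ _)
    have := Finset.card_le_card hsub
    rw [Finset.card_union_of_disjoint hdisj] at this
    omega

/-- **KN step I in giant form (PROVED).**  On `|A| ≤ 2j+1`, with `E = {o↔x} ∪ {o↔y}` and `D = {x↮c, y↮c}`:
`[μ(E, o heavy, c light, x heavy, y heavy) − μ(E, o light, c heavy, x light, y light)] · μ(D)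
   ≥ μ(D ∩ E) · [μ(x,y heavy, c light) − μ(c heavy, x,y light)]`   (KN: `I ≥ φ(12) (m₁₂ − m₃)`).
[cite: KozmaNitzan2024, proof of Thm. 2 (pp. 8–9); VandenbergHaggstromKahn2005, Thm. 2.1] -/
theorem pairStep (w : Sym2 (Fin n) → unitInterval) (A : Finset (Fin n)) (o c x y : Fin n) (j : ℕ) (hA : A.card ≤ 2 * j + 1) :
    ((prodBernoulli w).real (((openConn o x ∪ openConn o y) ∩ {ω : BondConfig (Fin n) | j + 1 ≤ (A.filter fun a => ω ∈ openConn o a).card} ∩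
            {ω | (A.filter fun a => ω ∈ openConn c a).card ≤ j}) ∩
          {ω | j + 1 ≤ (A.filter fun a => ω ∈ openConn x a).card} ∩ {ω | j + 1 ≤ (A.filter fun a => ω ∈ openConn y a).card}) -
        (prodBernoulli w).real (((openConn o x ∪ openConn o y) ∩ {ω : BondConfig (Fin n) | (A.filter fun a => ω ∈ openConn o a).card ≤ j} ∩
            {ω | j + 1 ≤ (A.filter fun a => ω ∈ openConn c a).card}) ∩
          {ω | (A.filter fun a => ω ∈ openConn x a).card ≤ j} ∩ {ω | (A.filter fun a => ω ∈ openConn y a).card ≤ j})) *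
      (prodBernoulli w).real {ω : BondConfig (Fin n) | ¬ (openGraph ω).Reachable x c ∧ ¬ (openGraph ω).Reachable y c} ≥
    (prodBernoulli w).real ({ω : BondConfig (Fin n) | ¬ (openGraph ω).Reachable x c ∧ ¬ (openGraph ω).Reachable y c} ∩
          (openConn o x ∪ openConn o y)) *
      ((prodBernoulli w).real ({ω : BondConfig (Fin n) | j + 1 ≤ (A.filter fun a => ω ∈ openConn x a).card} ∩
            {ω | j + 1 ≤ (A.filter fun a => ω ∈ openConn y a).card} ∩ {ω | (A.filter fun a => ω ∈ openConn c a).card ≤ j}) -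
        (prodBernoulli w).real ({ω : BondConfig (Fin n) | j + 1 ≤ (A.filter fun a => ω ∈ openConn c a).card} ∩
            {ω | (A.filter fun a => ω ∈ openConn x a).card ≤ j} ∩ {ω | (A.filter fun a => ω ∈ openConn y a).card ≤ j})) := by
  obtain ⟨card_eq, lh, ladder⟩ := toolkit A j hA
  set Hx : Set (BondConfig (Fin n)) := {ω | j + 1 ≤ (A.filter fun a => ω ∈ openConn x a).card} with hHx
  set Hy : Set (BondConfig (Fin n)) := {ω | j + 1 ≤ (A.filter fun a => ω ∈ openConn y a).card} with hHy
  set Hc : Set (BondConfig (Fin n)) := {ω | j + 1 ≤ (A.filter fun a => ω ∈ openConn c a).card} with hHc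
  set Ho : Set (BondConfig (Fin n)) := {ω | j + 1 ≤ (A.filter fun a => ω ∈ openConn o a).card} with hHo
  set Lx : Set (BondConfig (Fin n)) := {ω | (A.filter fun a => ω ∈ openConn x a).card ≤ j} with hLx
  set Ly : Set (BondConfig (Fin n)) := {ω | (A.filter fun a => ω ∈ openConn y a).card ≤ j} with hLy
  set Lc : Set (BondConfig (Fin n)) := {ω | (A.filter fun a => ω ∈ openConn c a).card ≤ j} with hLc
  set Lo : Set (BondConfig (Fin n)) := {ω | (A.filter fun a => ω ∈ openConn o a).card ≤ j} with hLo
  set E : Set (BondConfig (Fin n)) := (openConn o x ∪ openConn o y) with hE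
  set Ds : Set (BondConfig (Fin n)) := {ω | ¬ (openGraph ω).Reachable x c ∧ ¬ (openGraph ω).Reachable y c} with hDs
  set S1 : Set (Fin n) := {x, y} with hS1
  set T1 : Set (Fin n) := {c} with hT1
  have k1 := giant_knStep w A S1 T1 o j
  set D1 : Set (BondConfig (Fin n)) := {ω | ∀ s ∈ S1, ∀ t ∈ T1, ¬ (openGraph ω).Reachable s t} with hD1
  have mD1 : ∀ ω, ω ∈ D1 ↔ (¬ (openGraph ω).Reachable x c ∧ ¬ (openGraph ω).Reachable y c) := by
    intro ω; simp only [hD1, hS1, hT1, mem_setOf_eq, mem_insert_iff, mem_singleton_iff, forall_eq_or_imp, forall_eq]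
  set At1 : Set (BondConfig (Fin n)) := ⋃ s ∈ S1, (openConn s o : Set (BondConfig (Fin n))) with hAt1
  have mAt1 : ∀ ω, ω ∈ At1 ↔ ((openGraph ω).Reachable o x ∨ (openGraph ω).Reachable o y) := by
    intro ω; simp only [hAt1, hS1, mem_iUnion, exists_prop, mem_insert_iff, mem_singleton_iff, openConn, mem_setOf_eq]
    constructor
    · rintro ⟨s, (rfl | rfl), hs⟩
      · exact Or.inl hs.symm
      · exact Or.inr hs.symm
    · rintro (h | h)
      · exact ⟨x, Or.inl rfl, h.symm⟩
      · exact ⟨y, Or.inr rfl, h.symm⟩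
  set HS1 : Set (BondConfig (Fin n)) := {ω | ∀ s ∈ S1, j + 1 ≤ (A.filter fun a => ω ∈ openConn s a).card} with hHS1
  set HT1 : Set (BondConfig (Fin n)) := {ω | ∀ t ∈ T1, j + 1 ≤ (A.filter fun a => ω ∈ openConn t a).card} with hHT1
  have mHS1 : ∀ ω, ω ∈ HS1 ↔ (ω ∈ Hx ∧ ω ∈ Hy) := by
    intro ω; simp only [hHS1, hS1, hHx, hHy, mem_setOf_eq, mem_insert_iff, mem_singleton_iff, forall_eq_or_imp, forall_eq]
  have mHT1 : ∀ ω, ω ∈ HT1 ↔ ω ∈ Hc := by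
    intro ω; simp only [hHT1, hT1, hHc, mem_setOf_eq, mem_singleton_iff, forall_eq]
  have uHx : ∀ ω, ω ∈ Hx ↔ j + 1 ≤ (A.filter fun a => ω ∈ openConn x a).card := fun ω => Iff.rfl
  have uHy : ∀ ω, ω ∈ Hy ↔ j + 1 ≤ (A.filter fun a => ω ∈ openConn y a).card := fun ω => Iff.rfl
  have uHc : ∀ ω, ω ∈ Hc ↔ j + 1 ≤ (A.filter fun a => ω ∈ openConn c a).card := fun ω => Iff.rfl
  have uHo : ∀ ω, ω ∈ Ho ↔ j + 1 ≤ (A.filter fun a => ω ∈ openConn o a).card := fun ω => Iff.rfl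
  have uLx : ∀ ω, ω ∈ Lx ↔ (A.filter fun a => ω ∈ openConn x a).card ≤ j := fun ω => Iff.rfl
  have uLy : ∀ ω, ω ∈ Ly ↔ (A.filter fun a => ω ∈ openConn y a).card ≤ j := fun ω => Iff.rfl
  have uLc : ∀ ω, ω ∈ Lc ↔ (A.filter fun a => ω ∈ openConn c a).card ≤ j := fun ω => Iff.rfl
  have uLo : ∀ ω, ω ∈ Lo ↔ (A.filter fun a => ω ∈ openConn o a).card ≤ j := fun ω => Iff.rfl
  have mE : ∀ ω, ω ∈ E ↔ ((openGraph ω).Reachable o x ∨ (openGraph ω).Reachable o y) := by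
    intro ω; simp only [hE, mem_union, openConn, mem_setOf_eq]
  have mDs : ∀ ω, ω ∈ Ds ↔ (¬ (openGraph ω).Reachable x c ∧ ¬ (openGraph ω).Reachable y c) := fun ω => Iff.rfl
  have eI1 : D1 ∩ (At1 ∩ HS1) = (E ∩ Ho ∩ Lc) ∩ Hx ∩ Hy := by
    ext ω
    simp only [mem_inter_iff, and_assoc, mD1 ω, mAt1 ω, mHS1 ω, mE ω, uHx, uHy, uHo, uLc]
    constructor
    · rintro ⟨hxc', hyc', hatt, hX, hY⟩
      refine ⟨hatt, ?_, ladder (fun h => hxc' h.symm) hX, hX, hY⟩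
      rcases hatt with h | h
      · rw [card_eq h]; exact hX
      · rw [card_eq h]; exact hY
    · rintro ⟨hatt, _, hLc', hX, hY⟩
      exact ⟨fun h => lh hLc' hX h.symm, fun h => lh hLc' hY h.symm, hatt, hX, hY⟩
  have eI2 : D1 ∩ (At1 ∩ HT1) = (E ∩ Lo ∩ Hc) ∩ Lx ∩ Ly := by
    ext ω
    simp only [mem_inter_iff, and_assoc, mD1 ω, mAt1 ω, mHT1 ω, mE ω, uHc, uLo, uLx, uLy]
    constructor
    · rintro ⟨hxc', hyc', hatt, hC⟩
      have hLx' := ladder hxc' hC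
      have hLy' := ladder hyc' hC
      refine ⟨hatt, ?_, hC, hLx', hLy'⟩
      rcases hatt with h | h
      · rw [card_eq h]; exact hLx'
      · rw [card_eq h]; exact hLy'
    · rintro ⟨hatt, _, hC, hLx', hLy'⟩
      exact ⟨lh hLx' hC, lh hLy' hC, hatt, hC⟩
  have tI1 : D1 ∩ HS1 = Hx ∩ Hy ∩ Lc := by
    ext ω; simp only [mem_inter_iff, and_assoc, mD1 ω, mHS1 ω, uHx, uHy, uLc]
    constructor
    · rintro ⟨hxc', _, hX, hY⟩; exact ⟨hX, hY, ladder (fun h => hxc' h.symm) hX⟩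
    · rintro ⟨hX, hY, hLc'⟩; exact ⟨fun h => lh hLc' hX h.symm, fun h => lh hLc' hY h.symm, hX, hY⟩
  have tI2 : D1 ∩ HT1 = Hc ∩ Lx ∩ Ly := by
    ext ω; simp only [mem_inter_iff, and_assoc, mD1 ω, mHT1 ω, uHc, uLx, uLy]
    constructor
    · rintro ⟨hxc', hyc', hC⟩; exact ⟨hC, ladder hxc' hC, ladder hyc' hC⟩
    · rintro ⟨hC, hLx', hLy'⟩; exact ⟨lh hLx' hC, lh hLy' hC, hC⟩
  have eAt : D1 ∩ At1 = Ds ∩ E := by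
    ext ω; simp only [mem_inter_iff, mD1 ω, mAt1 ω, mDs ω, mE ω]
  have eD : D1 = Ds := by ext ω; rw [mD1 ω, mDs ω]
  rw [eI1, eI2, tI1, tI2, eAt, eD] at k1
  exact k1

/-- **KN step II in giant form (PROVED).**  On `|A| ≤ 2j+1`, with `E = {o↔u} ∪ {o↔v}` and `D = {u↮v, u↮c}`:
`[μ(E, o heavy, c light, u heavy, v light) − μ(E, o light, c heavy, v heavy)] · μ(D)
   ≥ μ(D ∩ {o↔u}) · [μ(u heavy, v,c light) − μ(v,c heavy, u light)]`   (KN: `II ≥ φ(1) (m₁ − m₂₃)`).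
[cite: KozmaNitzan2024, proof of Thm. 2 (pp. 8–9); VandenbergHaggstromKahn2005, Thm. 2.1] -/
theorem sideStep (w : Sym2 (Fin n) → unitInterval) (A : Finset (Fin n)) (o c u v : Fin n) (j : ℕ) (hA : A.card ≤ 2 * j + 1) :
    ((prodBernoulli w).real (((openConn o u ∪ openConn o v) ∩ {ω : BondConfig (Fin n) | j + 1 ≤ (A.filter fun a => ω ∈ openConn o a).card} ∩
            {ω | (A.filter fun a => ω ∈ openConn c a).card ≤ j}) ∩
          {ω | j + 1 ≤ (A.filter fun a => ω ∈ openConn u a).card} ∩ {ω | (A.filter fun a => ω ∈ openConn v a).card ≤ j}) -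
        (prodBernoulli w).real (((openConn o u ∪ openConn o v) ∩ {ω : BondConfig (Fin n) | (A.filter fun a => ω ∈ openConn o a).card ≤ j} ∩
            {ω | j + 1 ≤ (A.filter fun a => ω ∈ openConn c a).card}) ∩
          {ω | j + 1 ≤ (A.filter fun a => ω ∈ openConn v a).card})) *
      (prodBernoulli w).real {ω : BondConfig (Fin n) | ¬ (openGraph ω).Reachable u v ∧ ¬ (openGraph ω).Reachable u c} ≥
    (prodBernoulli w).real ({ω : BondConfig (Fin n) | ¬ (openGraph ω).Reachable u v ∧ ¬ (openGraph ω).Reachable u c} ∩ openConn o u) *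
      ((prodBernoulli w).real ({ω : BondConfig (Fin n) | j + 1 ≤ (A.filter fun a => ω ∈ openConn u a).card} ∩
            {ω | (A.filter fun a => ω ∈ openConn v a).card ≤ j} ∩ {ω | (A.filter fun a => ω ∈ openConn c a).card ≤ j}) -
        (prodBernoulli w).real ({ω : BondConfig (Fin n) | j + 1 ≤ (A.filter fun a => ω ∈ openConn v a).card} ∩
            {ω | j + 1 ≤ (A.filter fun a => ω ∈ openConn c a).card} ∩ {ω | (A.filter fun a => ω ∈ openConn u a).card ≤ j})) := by
  obtain ⟨card_eq, lh, ladder⟩ := toolkit A j hA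
  set Hx : Set (BondConfig (Fin n)) := {ω | j + 1 ≤ (A.filter fun a => ω ∈ openConn u a).card} with hHx
  set Hy : Set (BondConfig (Fin n)) := {ω | j + 1 ≤ (A.filter fun a => ω ∈ openConn v a).card} with hHy
  set Hc : Set (BondConfig (Fin n)) := {ω | j + 1 ≤ (A.filter fun a => ω ∈ openConn c a).card} with hHc
  set Ho : Set (BondConfig (Fin n)) := {ω | j + 1 ≤ (A.filter fun a => ω ∈ openConn o a).card} with hHo
  set Lx : Set (BondConfig (Fin n)) := {ω | (A.filter fun a => ω ∈ openConn u a).card ≤ j} with hLx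
  set Ly : Set (BondConfig (Fin n)) := {ω | (A.filter fun a => ω ∈ openConn v a).card ≤ j} with hLy
  set Lc : Set (BondConfig (Fin n)) := {ω | (A.filter fun a => ω ∈ openConn c a).card ≤ j} with hLc
  set Lo : Set (BondConfig (Fin n)) := {ω | (A.filter fun a => ω ∈ openConn o a).card ≤ j} with hLo
  set E : Set (BondConfig (Fin n)) := (openConn o u ∪ openConn o v) with hE
  set Ds : Set (BondConfig (Fin n)) := {ω | ¬ (openGraph ω).Reachable u v ∧ ¬ (openGraph ω).Reachable u c} with hDs
  set S2 : Set (Fin n) := {u} with hS2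
  set T2 : Set (Fin n) := {v, c} with hT2
  have k2 := giant_knStep w A S2 T2 o j
  set D2 : Set (BondConfig (Fin n)) := {ω | ∀ s ∈ S2, ∀ t ∈ T2, ¬ (openGraph ω).Reachable s t} with hD2
  have mD2 : ∀ ω, ω ∈ D2 ↔ (¬ (openGraph ω).Reachable u v ∧ ¬ (openGraph ω).Reachable u c) := by
    intro ω; simp only [hD2, hS2, hT2, mem_setOf_eq, mem_insert_iff, mem_singleton_iff, forall_eq_or_imp, forall_eq]
  set At2 : Set (BondConfig (Fin n)) := ⋃ s ∈ S2, (openConn s o : Set (BondConfig (Fin n))) with hAt2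
  have mAt2 : ∀ ω, ω ∈ At2 ↔ (openGraph ω).Reachable o u := by
    intro ω; simp only [hAt2, hS2, mem_iUnion, exists_prop, mem_singleton_iff, openConn, mem_setOf_eq]
    constructor
    · rintro ⟨s, rfl, hs⟩; exact hs.symm
    · intro h; exact ⟨u, rfl, h.symm⟩
  set HS2 : Set (BondConfig (Fin n)) := {ω | ∀ s ∈ S2, j + 1 ≤ (A.filter fun a => ω ∈ openConn s a).card} with hHS2
  set HT2 : Set (BondConfig (Fin n)) := {ω | ∀ t ∈ T2, j + 1 ≤ (A.filter fun a => ω ∈ openConn t a).card} with hHT2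
  have mHS2 : ∀ ω, ω ∈ HS2 ↔ ω ∈ Hx := by
    intro ω; simp only [hHS2, hS2, hHx, mem_setOf_eq, mem_singleton_iff, forall_eq]
  have mHT2 : ∀ ω, ω ∈ HT2 ↔ (ω ∈ Hy ∧ ω ∈ Hc) := by
    intro ω; simp only [hHT2, hT2, hHy, hHc, mem_setOf_eq, mem_insert_iff, mem_singleton_iff, forall_eq_or_imp, forall_eq]
  have uHx : ∀ ω, ω ∈ Hx ↔ j + 1 ≤ (A.filter fun a => ω ∈ openConn u a).card := fun ω => Iff.rfl
  have uHy : ∀ ω, ω ∈ Hy ↔ j + 1 ≤ (A.filter fun a => ω ∈ openConn v a).card := fun ω => Iff.rfl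
  have uHc : ∀ ω, ω ∈ Hc ↔ j + 1 ≤ (A.filter fun a => ω ∈ openConn c a).card := fun ω => Iff.rfl
  have uHo : ∀ ω, ω ∈ Ho ↔ j + 1 ≤ (A.filter fun a => ω ∈ openConn o a).card := fun ω => Iff.rfl
  have uLx : ∀ ω, ω ∈ Lx ↔ (A.filter fun a => ω ∈ openConn u a).card ≤ j := fun ω => Iff.rfl
  have uLy : ∀ ω, ω ∈ Ly ↔ (A.filter fun a => ω ∈ openConn v a).card ≤ j := fun ω => Iff.rfl
  have uLc : ∀ ω, ω ∈ Lc ↔ (A.filter fun a => ω ∈ openConn c a).card ≤ j := fun ω => Iff.rfl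
  have uLo : ∀ ω, ω ∈ Lo ↔ (A.filter fun a => ω ∈ openConn o a).card ≤ j := fun ω => Iff.rfl
  have mE : ∀ ω, ω ∈ E ↔ ((openGraph ω).Reachable o u ∨ (openGraph ω).Reachable o v) := by
    intro ω; simp only [hE, mem_union, openConn, mem_setOf_eq]
  have mDs : ∀ ω, ω ∈ Ds ↔ (¬ (openGraph ω).Reachable u v ∧ ¬ (openGraph ω).Reachable u c) := fun ω => Iff.rfl
  have eII1 : D2 ∩ (At2 ∩ HS2) = (E ∩ Ho ∩ Lc) ∩ Hx ∩ Ly := by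
    ext ω
    simp only [mem_inter_iff, and_assoc, mD2 ω, mAt2 ω, mHS2 ω, mE ω, uHx, uHo, uLc, uLy]
    constructor
    · rintro ⟨hxy', hxc', hox, hX⟩
      refine ⟨Or.inl hox, ?_, ladder (fun h => hxc' h.symm) hX, hX, ladder (fun h => hxy' h.symm) hX⟩
      rw [card_eq hox]; exact hX
    · rintro ⟨hatt, hHo, hLc', hX, hLy'⟩
      have hox : (openGraph ω).Reachable o u := by
        rcases hatt with h | h
        · exact h
        · exfalso; rw [card_eq h] at hHo; omega
      exact ⟨fun h => lh hLy' hX h.symm, fun h => lh hLc' hX h.symm, hox, hX⟩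
  have eII2 : D2 ∩ (At2 ∩ HT2) = (E ∩ Lo ∩ Hc) ∩ Hy := by
    ext ω
    simp only [mem_inter_iff, and_assoc, mD2 ω, mAt2 ω, mHT2 ω, mE ω, uHy, uHc, uLo]
    constructor
    · rintro ⟨_, hxc', hox, hY, hC⟩
      have hLx' := ladder hxc' hC
      refine ⟨Or.inl hox, ?_, hC, hY⟩
      rw [card_eq hox]; exact hLx'
    · rintro ⟨hatt, hLo', hC, hY⟩
      have hox : (openGraph ω).Reachable o u := by
        rcases hatt with h | h
        · exact h
        · exfalso; exact lh hLo' hY h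
      have hLx' : (A.filter fun a => ω ∈ openConn u a).card ≤ j := by rw [← card_eq hox]; exact hLo'
      exact ⟨lh hLx' hY, lh hLx' hC, hox, hY, hC⟩
  have tII1 : D2 ∩ HS2 = Hx ∩ Ly ∩ Lc := by
    ext ω; simp only [mem_inter_iff, and_assoc, mD2 ω, mHS2 ω, uHx, uLy, uLc]
    constructor
    · rintro ⟨hxy', hxc', hX⟩; exact ⟨hX, ladder (fun h => hxy' h.symm) hX, ladder (fun h => hxc' h.symm) hX⟩
    · rintro ⟨hX, hLy', hLc'⟩; exact ⟨fun h => lh hLy' hX h.symm, fun h => lh hLc' hX h.symm, hX⟩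
  have tII2 : D2 ∩ HT2 = Hy ∩ Hc ∩ Lx := by
    ext ω; simp only [mem_inter_iff, and_assoc, mD2 ω, mHT2 ω, uHy, uHc, uLx]
    constructor
    · rintro ⟨hxy', _, hY, hC⟩; exact ⟨hY, hC, ladder hxy' hY⟩
    · rintro ⟨hY, hC, hLx'⟩; exact ⟨lh hLx' hY, lh hLx' hC, hY, hC⟩
  have eAt : D2 ∩ At2 = Ds ∩ openConn o u := by
    ext ω; simp only [mem_inter_iff, mD2 ω, mAt2 ω, mDs ω, openConn, mem_setOf_eq]
  have eD : D2 = Ds := by ext ω; rw [mD2 ω, mDs ω]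
  rw [eII1, eII2, tII1, tII2, eAt, eD] at k2
  exact k2

end GiantKn

end Summit.CriticalPhenomena.PercolationContinuityZ3.Theorems

end
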